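import Summits.QuantumFields.YangMills.Theorems.LuscherReductionTwistedTraceScalingBTPointwise
import HarnessLib

/-!
# (B-T) AT RATE from a DRESSED near/far kernel comparison: `|T(boFun φ Ω) − c·⟨φW, K_B φW⟩| ≤ κc(⟨φW,K_BφW⟩ + λ₀‖φW‖²) + θ‖φ‖²` — the transfer step of `hT` for the rate twin
# (route `FlatTubeReduction`, crux K1 `NearFlatRatioLaw` stmt-QuantumFields-24720; seat `ym-line-ftr-p1` g14; rate twin «ratepack-v3 / frozen fibres»; R2b1 RECORD rung — no summit
# statement is proved here; template = lane A's `…BTPointwise.tubeForm_boFun_near_of_pointwise` for crux 20203)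

WHY (memo `Cruxes/NearFlatRatioLaw/Lines/ratepack-v3-frozen-g12.md` §5.1, §8.2).  Lane A's (B-T) transfer lemma compares the BO kernel `𝒦_β(u,u')` with `c·K̃₁^{(B)}(u,u')` with ONE relative
constant `κ` UNIFORMLY on the window — at the `β^{-1/6}` window this `κ` is `O(λ_b)`, not `O(λ_b²)`.  The rate twin's `hT` (`AnalyticRatePotInput.hT`) carries a DRESSING `W` inside the
one-site form and allows the slack `κ(σγ)·λ₀‖φ‖²`; the kernel comparison it needs is therefore `𝒦_β(u,u') ≈ c·W(u)W(u')·K̃₁(u,u')` with relative error `κ = O(λ_b²)` for NEAR pairs and an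
ABSOLUTE error `θ` (both kernels are Gaussian-small) for FAR pairs.  This file is the transfer step for that shape, with the near/far split folded into ONE pointwise hypothesis
`|𝒦 − cWW'K̃₁| ≤ κc|W||W'|K̃₁ + θ`:
* `sq_integral_abs_le_l2` — `(∫|φ|)² ≤ ‖φ‖²` on the one-site probability space (AM–GM, no Jensen);
* ★★★ `tubeForm_boFun_near_of_nearFar` — `|T(boFun φ Ω) − c⟨φW,K_BφW⟩| ≤ κc(⟨φW,K_BφW⟩ + λ₀(1,B)‖φW‖²) + θ‖φ‖²` for gauge-invariant bounded measurable `φ` supported in `{orbitDist < δ}`, `δ < 2`.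
HONEST FRAMING: measure-theoretic bookkeeping; the two kernel estimates (near pairs at rate with the symmetric dressing, far pairs absolutely small) are the open analytic content of hT;
femto rung R2b1 (RECORD label); not infinite volume, not a gap, not Clay.  No defs, no named facts, no `sorry`.
-/

set_option autoImplicit false

noncomputable section

open MeasureTheory Filter Topology Real
open scoped BigOperators
open Literature.MathematicalPhysics.QuantumFieldTheory
open Literature.MathematicalPhysics.QuantumLattice

namespace Summit.QuantumFields.YangMills.Theorems.FemtoTransferGap.TwoLattice.ConstTube

open Summit.QuantumFields.YangMills.Theorems.FemtoTransferGap
open Summit.QuantumFields.YangMills.Theorems.FemtoTransferGap.TwoLattice.Avg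
open Summit.QuantumFields.YangMills.Theorems.FemtoTransferGap.TwoLattice.Stiff (LinkSpace)

variable {L : ℕ} [NeZero L]

/-- `(∫|φ|)² ≤ ‖φ‖²_{L²}` for bounded measurable `φ` on the (probability) configuration space. [folklore] -/
theorem sq_integral_abs_le_l2 {M : ℕ} [NeZero M] {φ : GaugeConfig 3 M SU2 → ℝ} (hφm : Measurable φ) {C : ℝ} (hC : ∀ U, |φ U| ≤ C) :
    (∫ U, |φ U| ∂configMeasure SU2 M) ^ 2 ≤ l2 φ φ := by
  have hC0 : 0 ≤ C := (abs_nonneg _).trans (hC fun _ => 1)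
  have hi1 : Integrable (fun U => |φ U|) (configMeasure SU2 M) :=
    integrable_of_measurable_abs_le _ hφm.abs (C := C) fun U => by rw [abs_abs]; exact hC U
  have hi2 : Integrable (fun U => φ U * φ U) (configMeasure SU2 M) :=
    integrable_of_measurable_abs_le _ (hφm.mul hφm) (C := C * C) fun U => by rw [abs_mul]; exact mul_le_mul (hC U) (hC U) (abs_nonneg _) hC0
  set I : ℝ := ∫ U, |φ U| ∂configMeasure SU2 M with hI
  have hI0 : 0 ≤ I := integral_nonneg fun U => abs_nonneg _
  have hl2 : l2 φ φ = ∫ U, φ U * φ U ∂configMeasure SU2 M := rfl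
  have hq0 : 0 ≤ l2 φ φ := by rw [hl2]; exact integral_nonneg fun U => mul_self_nonneg _
  -- AM–GM: for every `t > 0`, `I ≤ (t‖φ‖² + 1/t)/2`
  have hamgm : ∀ t : ℝ, 0 < t → I ≤ (t * l2 φ φ + 1 / t) / 2 := by
    intro t ht
    have hpt : ∀ U, |φ U| ≤ (t * (φ U * φ U) + 1 / t) / 2 := fun U => by
      have h := sq_nonneg (t * |φ U| - 1)
      have e : φ U * φ U = |φ U| * |φ U| := (abs_mul_abs_self _).symm
      rw [e]
      have ht' : 0 < 2 * t := by positivity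
      rw [le_div_iff₀ (by norm_num : (0:ℝ) < 2)]
      have : |φ U| * 2 * t ≤ (t * (|φ U| * |φ U|) + 1 / t) * t := by
        rw [add_mul, one_div, inv_mul_cancel₀ ht.ne']
        nlinarith [h]
      nlinarith [this]
    calc I = ∫ U, |φ U| ∂configMeasure SU2 M := hI
      _ ≤ ∫ U, (t * (φ U * φ U) + 1 / t) / 2 ∂configMeasure SU2 M := integral_mono hi1 (((hi2.const_mul t).add (integrable_const _)).div_const 2) hpt
      _ = (t * l2 φ φ + 1 / t) / 2 := by
          rw [integral_div, integral_add (hi2.const_mul t) (integrable_const _), integral_const_mul, integral_const, hl2]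
          simp
  by_cases hq : l2 φ φ = 0
  · -- then `I ≤ 1/(2t)` for all `t`, so `I = 0`
    have hI0' : I = 0 := by
      by_contra hne
      have hIpos : 0 < I := lt_of_le_of_ne hI0 (Ne.symm hne)
      have h := hamgm (1 / I) (by positivity)
      rw [hq, mul_zero, zero_add, one_div_one_div] at h
      linarith
    rw [hI0', hq]; norm_num
  · have hqpos : 0 < l2 φ φ := lt_of_le_of_ne hq0 (Ne.symm hq)
    set s : ℝ := Real.sqrt (l2 φ φ) with hs
    have hs0 : 0 < s := Real.sqrt_pos.mpr hqpos
    have hss : s * s = l2 φ φ := Real.mul_self_sqrt hq0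
    have h := hamgm (1 / s) (by positivity)
    have e : (1 / s * l2 φ φ + 1 / (1 / s)) / 2 = s := by
      rw [one_div_one_div, ← hss]; field_simp; ring
    rw [e] at h
    calc I ^ 2 ≤ s ^ 2 := pow_le_pow_left₀ hI0 h 2
      _ = l2 φ φ := by rw [sq, hss]

set_option maxHeartbeats 1600000 in
/-- ★★★ **(B-T) AT RATE FROM THE DRESSED NEAR/FAR KERNEL COMPARISON.**  `B ≥ 0`, `Ω` bounded measurable, `c, κ, θ ≥ 0`, `δ < 2`; a dressing `W` (bounded measurable gauge
invariant) with, for all `u, u'` in `{orbitDist < δ}`:  `|𝒦_β(u,u') − c·W(u)W(u')·K̃₁^{(B)}(u,u')| ≤ κ·c·|W(u)||W(u')|·K̃₁^{(B)}(u,u') + θ`.  Then for every gauge-invariant bounded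
measurable `φ` supported in `{orbitDist < δ}`:
`|T(boFun φ Ω) − c·⟨φW, K_B φW⟩| ≤ κ·c·(⟨φW, K_B φW⟩ + λ₀(1,B)·‖φW‖²) + θ·‖φ‖²`. [cite: Luscher1983, §3] -/
theorem tubeForm_boFun_near_of_nearFar (β : ℝ) {B : ℝ} (hB : 0 ≤ B) {Ω : LinkSpace L → ℝ} (hΩ : Measurable Ω) {CΩ : ℝ} (hCΩ : ∀ x, |Ω x| ≤ CΩ)
    {c κ θ δ : ℝ} (hc : 0 ≤ c) (hκ : 0 ≤ κ) (hθ : 0 ≤ θ) (hδ : δ < 2)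
    {W : GaugeConfig 3 1 SU2 → ℝ} (hWm : Measurable W) {CW : ℝ} (hCW : ∀ u, |W u| ≤ CW) (hWg : ∀ (g : Site 3 1 → SU2) (u : GaugeConfig 3 1 SU2), W (gaugeTransform g u) = W u)
    (hpt : ∀ u u' : GaugeConfig 3 1 SU2, orbitDist u < δ → orbitDist u' < δ →
      |boKernel L β Ω u u' - c * (W u * W u') * avgKernel B u u'| ≤ κ * c * (|W u| * |W u'|) * avgKernel B u u' + θ)
    {φ : GaugeConfig 3 1 SU2 → ℝ} (hφm : Measurable φ) {Cφ : ℝ} (hCφ : ∀ u, |φ u| ≤ Cφ)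
    (hφg : ∀ (g : Site 3 1 → SU2) (u : GaugeConfig 3 1 SU2), φ (gaugeTransform g u) = φ u) (hsupp : ∀ u, φ u ≠ 0 → orbitDist u < δ) :
    |tubeForm β (boFun L φ Ω) - c * qform su2Rep B (fun u => φ u * W u) (fun u => φ u * W u)| ≤
      κ * c * (qform su2Rep B (fun u => φ u * W u) (fun u => φ u * W u) + levelValue su2Rep 1 B 0 * l2 (fun u => φ u * W u) (fun u => φ u * W u)) + θ * l2 φ φ := by
  have hCφ0 : 0 ≤ Cφ := (abs_nonneg _).trans (hCφ 1)
  have hCW0 : 0 ≤ CW := (abs_nonneg _).trans (hCW 1)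
  obtain ⟨MB, hMB0, hMB⟩ := exists_avgKernel_le (L := 1) B
  obtain ⟨KB, hKB0, hKB⟩ := abs_boKernel_le (L := L) β hCΩ
  -- the dressed amplitude `ψ = φW`
  set ψ : GaugeConfig 3 1 SU2 → ℝ := fun u => φ u * W u with hψ
  have hψm : Measurable ψ := hφm.mul hWm
  have hψC : ∀ u, |ψ u| ≤ Cφ * CW := fun u => by rw [hψ]; dsimp only; rw [abs_mul]; exact mul_le_mul (hCφ u) (hCW u) (abs_nonneg _) hCφ0
  have hψg : ∀ (g : Site 3 1 → SU2) (u : GaugeConfig 3 1 SU2), ψ (gaugeTransform g u) = ψ u := fun g u => by simp only [hψ, hφg, hWg]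
  have hψsupp : ∀ u, ψ u ≠ 0 → orbitDist u < δ := fun u h => hsupp u (left_ne_zero_of_mul h)
  -- the row functions
  set A : GaugeConfig 3 1 SU2 → ℝ := fun u => ∫ u', boKernel L β Ω u u' * φ u' ∂configMeasure SU2 1 with hA
  set R : GaugeConfig 3 1 SU2 → ℝ := fun u => ∫ u', avgKernel B u u' * ψ u' ∂configMeasure SU2 1 with hR
  set Rabs : GaugeConfig 3 1 SU2 → ℝ := fun u => ∫ u', avgKernel B u u' * |ψ u'| ∂configMeasure SU2 1 with hRabs
  set I₁ : ℝ := ∫ u', |φ u'| ∂configMeasure SU2 1 with hI₁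
  have hT : tubeForm β (boFun L φ Ω) = ∫ u, φ u * A u ∂configMeasure SU2 1 := tubeForm_boFun_eq β hφm hCφ hΩ hCΩ
  have hQ : qform su2Rep B ψ ψ = ∫ u, ψ u * R u ∂configMeasure SU2 1 := qform_eq_integral_avgKernel_of_invariant B hψm hψC hψg
  have hψam : Measurable fun u => |ψ u| := hψm.abs
  have hψaC : ∀ u, |(fun u => |ψ u|) u| ≤ Cφ * CW := fun u => by dsimp only; rw [abs_abs]; exact hψC u
  have hψag : ∀ (g : Site 3 1 → SU2) (u : GaugeConfig 3 1 SU2), (fun u => |ψ u|) (gaugeTransform g u) = (fun u => |ψ u|) u := fun g u => by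
    simp only [hψg]
  have hQabs : qform su2Rep B (fun u => |ψ u|) (fun u => |ψ u|) = ∫ u, |ψ u| * Rabs u ∂configMeasure SU2 1 :=
    qform_eq_integral_avgKernel_of_invariant B hψam hψaC hψag
  -- integrability of the rows
  have hintA : ∀ u, Integrable (fun u' => boKernel L β Ω u u' * φ u') (configMeasure SU2 1) := fun u =>
    integrable_of_measurable_abs_le _ ((measurable_boKernel_right (L := L) β hΩ u).mul hφm) (C := KB * Cφ) fun u' => by
      rw [abs_mul]; exact mul_le_mul (hKB u u') (hCφ u') (abs_nonneg _) hKB0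
  have hintKφ : ∀ u, Integrable (fun u' => c * (W u * W u') * avgKernel B u u' * φ u') (configMeasure SU2 1) := fun u =>
    integrable_of_measurable_abs_le _ (((measurable_const.mul (measurable_const.mul hWm)).mul (measurable_avgKernel_right B u)).mul hφm)
      (C := c * (CW * CW) * MB * Cφ) fun u' => by
      rw [abs_mul, abs_mul, abs_mul, abs_of_nonneg hc, abs_mul, abs_of_pos (avgKernel_pos B _ _)]
      have h1 : |W u| * |W u'| ≤ CW * CW := mul_le_mul (hCW u) (hCW u') (abs_nonneg _) hCW0
      have h2 : c * (|W u| * |W u'|) * avgKernel B u u' ≤ c * (CW * CW) * MB :=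
        mul_le_mul (mul_le_mul_of_nonneg_left h1 hc) (hMB u u') (avgKernel_pos B _ _).le (by positivity)
      exact mul_le_mul h2 (hCφ u') (abs_nonneg _) (by positivity)
  have hintRabs : ∀ u, Integrable (fun u' => avgKernel B u u' * |ψ u'|) (configMeasure SU2 1) := fun u =>
    integrable_of_measurable_abs_le _ ((measurable_avgKernel_right B u).mul hψam) (C := MB * (Cφ * CW)) fun u' => by
      rw [abs_mul, abs_of_pos (avgKernel_pos B _ _), abs_abs]; exact mul_le_mul (hMB u u') (hψC u') (abs_nonneg _) hMB0.le
  have hintφabs : Integrable (fun u' => |φ u'|) (configMeasure SU2 1) :=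
    integrable_of_measurable_abs_le _ hφm.abs (C := Cφ) fun u' => by rw [abs_abs]; exact hCφ u'
  -- the dressed row: `c·ψ(u)·R(u) = φ(u)·∫ cW(u)W(u')K̃(u,u')φ(u') du'`
  have hRrow : ∀ u, c * (ψ u * R u) = φ u * ∫ u', c * (W u * W u') * avgKernel B u u' * φ u' ∂configMeasure SU2 1 := by
    intro u
    rw [hR, hψ]; dsimp only
    simp only [← integral_const_mul]
    exact integral_congr_ae (ae_of_all _ fun u' => by ring)
  have hψabs : ∀ u, |ψ u| = |φ u| * |W u| := fun u => by rw [hψ]; dsimp only; rw [abs_mul]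
  -- pointwise row estimate
  have hrow : ∀ u, |φ u * A u - c * (ψ u * R u)| ≤ κ * c * (|ψ u| * Rabs u) + θ * (|φ u| * I₁) := by
    intro u
    by_cases hu : φ u = 0
    · have : ψ u = 0 := by rw [hψ]; dsimp only; rw [hu, zero_mul]
      simp [hu, this]
    have hud : orbitDist u < δ := hsupp u hu
    have e1 : φ u * A u - c * (ψ u * R u) = φ u * ∫ u', (boKernel L β Ω u u' - c * (W u * W u') * avgKernel B u u') * φ u' ∂configMeasure SU2 1 := by
      rw [hRrow u, hA]; dsimp only
      rw [show (fun u' => (boKernel L β Ω u u' - c * (W u * W u') * avgKernel B u u') * φ u') =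
          fun u' => boKernel L β Ω u u' * φ u' - c * (W u * W u') * avgKernel B u u' * φ u' by funext u'; ring,
        integral_sub (hintA u) (hintKφ u)]
      ring
    have hI : |∫ u', (boKernel L β Ω u u' - c * (W u * W u') * avgKernel B u u') * φ u' ∂configMeasure SU2 1| ≤
        κ * c * |W u| * Rabs u + θ * I₁ := by
      calc |∫ u', (boKernel L β Ω u u' - c * (W u * W u') * avgKernel B u u') * φ u' ∂configMeasure SU2 1|
          ≤ ∫ u', |(boKernel L β Ω u u' - c * (W u * W u') * avgKernel B u u') * φ u'| ∂configMeasure SU2 1 := abs_integral_le_integral_abs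
        _ ≤ ∫ u', (κ * c * |W u| * (avgKernel B u u' * |ψ u'|) + θ * |φ u'|) ∂configMeasure SU2 1 := by
            refine integral_mono_of_nonneg (ae_of_all _ fun _ => abs_nonneg _) (((hintRabs u).const_mul _).add (hintφabs.const_mul θ)) (ae_of_all _ fun u' => ?_)
            show |(boKernel L β Ω u u' - c * (W u * W u') * avgKernel B u u') * φ u'| ≤ κ * c * |W u| * (avgKernel B u u' * |ψ u'|) + θ * |φ u'|
            rw [abs_mul]
            by_cases hu' : φ u' = 0
            · rw [hu', abs_zero, mul_zero]
              have := avgKernel_pos B u u'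
              positivity
            · calc |boKernel L β Ω u u' - c * (W u * W u') * avgKernel B u u'| * |φ u'| ≤ (κ * c * (|W u| * |W u'|) * avgKernel B u u' + θ) * |φ u'| :=
                    mul_le_mul_of_nonneg_right (hpt u u' hud (hsupp u' hu')) (abs_nonneg _)
                _ = κ * c * |W u| * (avgKernel B u u' * |ψ u'|) + θ * |φ u'| := by rw [hψabs u']; ring
        _ = κ * c * |W u| * Rabs u + θ * I₁ := by
            rw [integral_add ((hintRabs u).const_mul _) (hintφabs.const_mul θ), integral_const_mul, integral_const_mul]
    rw [e1, abs_mul]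
    calc |φ u| * |∫ u', (boKernel L β Ω u u' - c * (W u * W u') * avgKernel B u u') * φ u' ∂configMeasure SU2 1| ≤ |φ u| * (κ * c * |W u| * Rabs u + θ * I₁) :=
          mul_le_mul_of_nonneg_left hI (abs_nonneg _)
      _ = κ * c * (|ψ u| * Rabs u) + θ * (|φ u| * I₁) := by rw [hψabs u]; ring
  -- integrate the row estimate
  have hintφA : Integrable (fun u => φ u * A u) (configMeasure SU2 1) := by
    have hAm : Measurable A := by
      have hF : Measurable fun p : GaugeConfig 3 1 SU2 × GaugeConfig 3 1 SU2 => boKernel L β Ω p.1 p.2 * φ p.2 :=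
        (measurable_boKernel (L := L) β hΩ).mul (hφm.comp measurable_snd)
      have h := (hF.stronglyMeasurable.integral_prod_right' (ν := configMeasure SU2 1)).measurable
      rw [hA]; simpa only using h
    refine integrable_of_measurable_abs_le _ (hφm.mul hAm) (C := Cφ * (KB * Cφ)) fun u => ?_
    rw [abs_mul]
    refine mul_le_mul (hCφ u) ?_ (abs_nonneg _) hCφ0
    calc |A u| ≤ ∫ u', |boKernel L β Ω u u' * φ u'| ∂configMeasure SU2 1 := abs_integral_le_integral_abs
      _ ≤ ∫ _u', KB * Cφ ∂configMeasure SU2 1 :=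
          integral_mono_of_nonneg (ae_of_all _ fun _ => abs_nonneg _) (integrable_const _) (ae_of_all _ fun u' => by
            show |boKernel L β Ω u u' * φ u'| ≤ KB * Cφ
            rw [abs_mul]; exact mul_le_mul (hKB u u') (hCφ u') (abs_nonneg _) hKB0)
      _ = KB * Cφ := by simp
  have hintψR : Integrable (fun u => ψ u * R u) (configMeasure SU2 1) := integrable_mul_integral_avgKernel B hψm hψC hψm hψC
  have hintψRabs : Integrable (fun u => |ψ u| * Rabs u) (configMeasure SU2 1) := integrable_mul_integral_avgKernel B hψam hψaC hψam hψaC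
  have hintφI : Integrable (fun u => |φ u| * I₁) (configMeasure SU2 1) := hintφabs.mul_const _
  have hdiff : tubeForm β (boFun L φ Ω) - c * qform su2Rep B ψ ψ = ∫ u, (φ u * A u - c * (ψ u * R u)) ∂configMeasure SU2 1 := by
    rw [hT, hQ, ← integral_const_mul, ← integral_sub hintφA (hintψR.const_mul c)]
  have habs : |tubeForm β (boFun L φ Ω) - c * qform su2Rep B ψ ψ| ≤ κ * c * qform su2Rep B (fun u => |ψ u|) (fun u => |ψ u|) + θ * I₁ ^ 2 := by
    rw [hdiff, hQabs]
    calc |∫ u, (φ u * A u - c * (ψ u * R u)) ∂configMeasure SU2 1| ≤ ∫ u, |φ u * A u - c * (ψ u * R u)| ∂configMeasure SU2 1 := abs_integral_le_integral_abs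
      _ ≤ ∫ u, (κ * c * (|ψ u| * Rabs u) + θ * (|φ u| * I₁)) ∂configMeasure SU2 1 :=
          integral_mono_of_nonneg (ae_of_all _ fun _ => abs_nonneg _) ((hintψRabs.const_mul _).add (hintφI.const_mul θ)) (ae_of_all _ hrow)
      _ = κ * c * (∫ u, |ψ u| * Rabs u ∂configMeasure SU2 1) + θ * ((∫ u, |φ u| ∂configMeasure SU2 1) * I₁) := by
          rw [integral_add (hintψRabs.const_mul _) (hintφI.const_mul θ), integral_const_mul, integral_const_mul, integral_mul_const]
      _ = κ * c * (∫ u, |ψ u| * Rabs u ∂configMeasure SU2 1) + θ * I₁ ^ 2 := by rw [← hI₁, sq]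
  -- the top bound, nonnegativity, `(∫|φ|)² ≤ ‖φ‖²`
  have htop : qform su2Rep B (fun u => |ψ u|) (fun u => |ψ u|) ≤ levelValue su2Rep 1 B 0 * l2 ψ ψ :=
    qform_abs_le_levelValue_zero_mul hB hψm hψC hψg (by simpa using hδ) hψsupp
  have hnn : 0 ≤ qform su2Rep B ψ ψ := qform_self_nonneg_of_bounded hB hψm hψC
  have hκc : 0 ≤ κ * c := mul_nonneg hκ hc
  have hI2 : I₁ ^ 2 ≤ l2 φ φ := sq_integral_abs_le_l2 hφm hCφ
  calc |tubeForm β (boFun L φ Ω) - c * qform su2Rep B ψ ψ| ≤ κ * c * qform su2Rep B (fun u => |ψ u|) (fun u => |ψ u|) + θ * I₁ ^ 2 := habs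
    _ ≤ κ * c * (levelValue su2Rep 1 B 0 * l2 ψ ψ) + θ * l2 φ φ := add_le_add (mul_le_mul_of_nonneg_left htop hκc) (mul_le_mul_of_nonneg_left hI2 hθ)
    _ ≤ κ * c * (qform su2Rep B ψ ψ + levelValue su2Rep 1 B 0 * l2 ψ ψ) + θ * l2 φ φ := by nlinarith

end Summit.QuantumFields.YangMills.Theorems.FemtoTransferGap.TwoLattice.ConstTube

end
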